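import Literature.AlgebraicGeometry.Resolution.ExcellentRings
import Mathlib.RingTheory.Ideal.KrullsHeightTheorem
import Mathlib.RingTheory.RegularLocalRing.Polynomial
import Mathlib.RingTheory.Ideal.Height
import Mathlib.RingTheory.Localization.Ideal
import Mathlib.RingTheory.Localization.AtPrime.Basic
import Mathlib.RingTheory.Spectrum.Prime.RingHom
import Mathlib.Order.KrullDimension
import HarnessLib

/-!
# Catenary rings: permanence, local nature, and chain-length criteria

Topic: `Literature/AlgebraicGeometry/Resolution`. `ExcellentRings.lean` defines `IsCatenaryRing`
(Matsumura §5, p. 31: for primes `𝔭 ⊆ 𝔮` a saturated chain from `𝔭` to `𝔮` exists and all such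
chains have the same length; chains are `LTSeries` in `Spec`, saturated = consecutive `⋖`) and
`IsUniversallyCatenaryRing` (Noetherian + every finitely generated algebra catenary), but proves
nothing about them beyond the one-point case. This file supplies the standard permanence and
locality statements (Stacks, Algebra, Section 00NH "Catenary rings") and the two chain-length
criteria through which catenarity of Cohen–Macaulay and regular rings, and of complete local
rings (Stacks 032C, needed for `Stacks07QW_complete`), is proved. Everything is PROVED; no named
facts are introduced.

## Content (namespace `Literature.AlgebraicGeometry.Resolution`)

Partial orders (the combinatorial core):
* `forall_covBy_map_iff`, `exists_ltSeries_lift`, `saturated_clause_iff` — saturated chains and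
  the condition "saturated chains from `a` to `b` exist and all have the same length" transport
  along an order embedding with order-connected range.
* `forall_covBy_smash` — concatenation of saturated chains is saturated.
* `exists_saturated_ltSeries` — below a point of finite height every `a ≤ b` is joined by a
  saturated chain (a chain of maximal length).

Rings:
* `saturatedChain_clause_iff` — the same transport for `Spec C ↪ Spec B`;
  `exists_orderEmbedding_of_surjective` (`Spec C ≅ V(ker f)`),
  `exists_orderEmbedding_of_isLocalization` (`Spec S⁻¹B ≅ {𝔭 ∣ 𝔭 ∩ S = ∅}`).
* `IsCatenaryRing.of_surjective`, `.quotient`, `.of_ringEquiv` — Stacks 00NK.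
* `isCatenaryRing_of_forall_exists_quotient`, `isCatenaryRing_of_minimalPrimes` — catenarity is
  decided on quotients `B/I`, `I ⊆ 𝔭` (Stacks 0AUP (1)).
* `IsCatenaryRing.of_isLocalization` — Stacks 00NJ; `isCatenaryRing_of_localization_maximal`,
  `isCatenaryRing_of_localization_prime`, `isCatenaryRing_of_clause_closedPoint` — catenarity is
  local (Stacks 0AUN), the last in the form "chains from `P` to the closed point of `Spec B_𝔮`".
* `exists_isSaturatedChain` — saturated chains exist in Noetherian rings;
  `height_last_eq_of_isSaturatedChain`, `isCatenaryRing_of_height_eq_height_add_one` — a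
  Noetherian ring with `ht 𝔮 = ht 𝔭 + 1` for all covers `𝔭 ⋖ 𝔮` is catenary;
  `saturatedChain_clause_of_minimalPrimes`, `isCatenaryRing_of_minimalPrimes_clause` — it
  suffices to control chains issuing from minimal primes (the form of Stacks 00N9).
* `IsUniversallyCatenaryRing.of_finiteType`, `.of_finite`, `.of_surjective`, `.quotient`,
  `.isCatenaryRing_of_finiteType` — Stacks 0ECE, 00NK;
  `isUniversallyCatenaryRing_of_mvPolynomial` — it suffices that the `A[X_1, …, X_n]` are catenary
  (Stacks, remark after 00NL); `isUniversallyCatenaryRing_of_isRegularRing` — regular rings are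
  universally catenary GIVEN that regular local rings are catenary (the assembly of Stacks
  00NM/00NQ = Matsumura Thms. 17.8, 17.9 around its single local input, Thm. 17.4 (ii)).

## Not here

The local input itself — a regular (more generally Cohen–Macaulay) local ring is catenary
(Matsumura Thm. 17.4; Stacks 00N9) — which needs the unmixedness theory of Cohen–Macaulay rings
absent from Mathlib; and Stacks 00NJ for universally catenary rings (localisations).

## Sources

* The Stacks Project, Algebra, Section 00NH (Tags 00NI, 00NJ, 00NK, 00NL, 0AUN, 0AUP, 0ECE,
  00NM). [StacksProject]
* H. Matsumura, *Commutative Ring Theory*, CUP 1986, §5 p. 31 (catenary), §15 p. 116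
  (universally catenary), Thms. 17.4, 17.8, 17.9. [Matsumura1987]
-/

noncomputable section

namespace Literature.AlgebraicGeometry.Resolution

universe u

section Poset

variable {α β : Type*} [PartialOrder α] [PartialOrder β]

/-- The image of a strict chain under an order embedding with order-connected range is saturated
iff the chain is. [folklore] -/
theorem forall_covBy_map_iff (f : α ↪o β) (hf : (Set.range f).OrdConnected) (s : LTSeries α) :
    (∀ i : Fin s.length, (s.map f f.strictMono) i.castSucc ⋖ (s.map f f.strictMono) i.succ) ↔
      ∀ i : Fin s.length, s i.castSucc ⋖ s i.succ :=
  forall_congr' fun i => by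
    show f (s i.castSucc) ⋖ f (s i.succ) ↔ _
    exact hf.apply_covBy_apply_iff f

/-- A strict chain between two points of the range of an order embedding with order-connected
range lifts along the embedding, with the same length, and the lift is saturated iff the chain
is. [folklore] -/
theorem exists_ltSeries_lift (f : α ↪o β) (hf : (Set.range f).OrdConnected) {a b : α}
    (t : LTSeries β) (hta : t.head = f a) (htb : t.last = f b) :
    ∃ s : LTSeries α, s.head = a ∧ s.last = b ∧ s.length = t.length ∧
      ((∀ i : Fin s.length, s i.castSucc ⋖ s i.succ) ↔ ∀ i : Fin t.length, t i.castSucc ⋖ t i.succ) := by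
  have hmem : ∀ i : Fin (t.length + 1), t i ∈ Set.range f := fun i =>
    hf.out ⟨a, rfl⟩ ⟨b, rfl⟩ ⟨hta ▸ t.monotone (Fin.zero_le i), htb ▸ t.monotone (Fin.le_last i)⟩
  choose g hg using hmem
  have hgmono : StrictMono g := fun i j hij =>
    f.lt_iff_lt.mp (by rw [hg, hg]; exact t.strictMono hij)
  refine ⟨LTSeries.mk t.length g hgmono, f.injective ?_, f.injective ?_, rfl,
    forall_congr' fun i => ?_⟩
  · show f (g 0) = f a
    rw [hg]; exact hta
  · show f (g (Fin.last _)) = f b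
    rw [hg]; exact htb
  · show g i.castSucc ⋖ g i.succ ↔ _
    rw [← hf.apply_covBy_apply_iff f, hg, hg]
    exact Iff.rfl

/-- **Transport of the catenary condition along an order embedding with order-connected range**
(e.g. `Spec(B/I) ≅ V(I) ⊆ Spec B`, `Spec(S⁻¹B) ⊆ Spec B`): "there is a saturated chain from `a` to
`b`, and all of them have the same length" holds for `(a, b)` iff it holds for `(f a, f b)`.
[folklore] -/
theorem saturated_clause_iff (f : α ↪o β) (hf : (Set.range f).OrdConnected) (a b : α) :
    (∃ n : ℕ, (∃ s : LTSeries α, s.head = a ∧ s.last = b ∧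
        (∀ i : Fin s.length, s i.castSucc ⋖ s i.succ) ∧ s.length = n) ∧
      ∀ s : LTSeries α, s.head = a → s.last = b →
        (∀ i : Fin s.length, s i.castSucc ⋖ s i.succ) → s.length = n) ↔
    (∃ n : ℕ, (∃ t : LTSeries β, t.head = f a ∧ t.last = f b ∧
        (∀ i : Fin t.length, t i.castSucc ⋖ t i.succ) ∧ t.length = n) ∧
      ∀ t : LTSeries β, t.head = f a → t.last = f b →
        (∀ i : Fin t.length, t i.castSucc ⋖ t i.succ) → t.length = n) := by
  constructor
  · rintro ⟨n, ⟨s, hsa, hsb, hs, hsn⟩, huniq⟩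
    refine ⟨n, ⟨s.map f f.strictMono, by rw [LTSeries.head_map, hsa], by rw [LTSeries.last_map, hsb],
      (forall_covBy_map_iff f hf s).mpr hs, hsn⟩, fun t hta htb ht => ?_⟩
    obtain ⟨s', hs'a, hs'b, hlen, hiff⟩ := exists_ltSeries_lift f hf t hta htb
    rw [← hlen]
    exact huniq s' hs'a hs'b (hiff.mpr ht)
  · rintro ⟨n, ⟨t, hta, htb, ht, htn⟩, huniq⟩
    obtain ⟨s, hsa, hsb, hlen, hiff⟩ := exists_ltSeries_lift f hf t hta htb
    refine ⟨n, ⟨s, hsa, hsb, hiff.mpr ht, hlen.trans htn⟩, fun s' hs'a hs'b hs' => ?_⟩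
    exact huniq (s'.map f f.strictMono) (by rw [LTSeries.head_map, hs'a])
      (by rw [LTSeries.last_map, hs'b]) ((forall_covBy_map_iff f hf s').mpr hs')

/-- Concatenating two saturated chains (the first ending where the second starts) gives a
saturated chain. [folklore] -/
theorem forall_covBy_smash {p q : LTSeries α} (h : p.last = q.head)
    (hp : ∀ i : Fin p.length, p i.castSucc ⋖ p i.succ)
    (hq : ∀ i : Fin q.length, q i.castSucc ⋖ q i.succ) :
    ∀ i : Fin (p.length + q.length), (p.smash q h) i.castSucc ⋖ (p.smash q h) i.succ := by
  refine Fin.addCases (fun i => ?_) (fun i => ?_)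
  · rw [RelSeries.smash_castAdd, RelSeries.smash_succ_castAdd]
    exact hp i
  · rw [RelSeries.smash_natAdd, RelSeries.smash_succ_natAdd]
    exact hq i

/-- **Saturated chains exist below points of finite height**: if `a ≤ b` and `b` has finite
height, some strict chain from `a` to `b` is saturated (a chain from `a` to `b` of maximal length;
lengths are bounded by the height of `b`). [folklore] -/
theorem exists_saturated_ltSeries {a b : α} (hab : a ≤ b) (hb : Order.height b < ⊤) :
    ∃ s : LTSeries α, s.head = a ∧ s.last = b ∧ ∀ i : Fin s.length, s i.castSucc ⋖ s i.succ := by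
  classical
  set L : Set ℕ := {n | ∃ s : LTSeries α, s.head = a ∧ s.last = b ∧ s.length = n} with hL
  have hne : L.Nonempty := by
    rcases hab.eq_or_lt with rfl | hlt
    · exact ⟨0, RelSeries.singleton _ a, rfl, rfl, rfl⟩
    · exact ⟨1, (RelSeries.singleton _ a).snoc b hlt, rfl, RelSeries.last_snoc _ _ _, rfl⟩
  obtain ⟨m, hm⟩ := ENat.ne_top_iff_exists.mp hb.ne
  have hbdd : BddAbove L := by
    refine ⟨m, fun n ⟨s, _, hsb, hsn⟩ => ?_⟩
    have h := Order.length_le_height_last (p := s)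
    rw [hsb, ← hm, hsn] at h
    exact_mod_cast h
  obtain ⟨s, hsa, hsb, hsn⟩ := Nat.sSup_mem hne hbdd
  refine ⟨s, hsa, hsb, fun i => ?_⟩
  by_contra hcov
  obtain ⟨c, hac, hcb⟩ := (not_covBy_iff (s.strictMono i.castSucc_lt_succ)).mp hcov
  -- splice `c` in: a strictly longer chain from `a` to `b`
  set s₁ : LTSeries α := (s.take i.castSucc).snoc c (by rw [RelSeries.last_take]; exact hac)
    with hs₁
  set s₂ : LTSeries α := (s.drop i.succ).cons c (by rw [RelSeries.head_drop]; exact hcb) with hs₂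
  have hconn : s₁.last = s₂.head := by
    rw [hs₁, hs₂, RelSeries.last_snoc, RelSeries.head_cons]
  set s' : LTSeries α := s₁.smash s₂ hconn with hs'
  have hlen : s'.length = s.length + 1 := by
    have hi : (i : ℕ) < s.length := i.2
    simp only [hs', hs₁, hs₂, RelSeries.smash, RelSeries.snoc, RelSeries.cons, RelSeries.append,
      RelSeries.singleton, RelSeries.take, RelSeries.drop_length, Fin.val_castSucc, Fin.val_succ]
    omega
  have hmem : s.length + 1 ∈ L := by
    refine ⟨s', ?_, ?_, hlen⟩
    · rw [hs', RelSeries.head_smash, hs₁, RelSeries.head_snoc, RelSeries.head_take, hsa]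
    · rw [hs', RelSeries.last_smash, hs₂, RelSeries.last_cons, RelSeries.last_drop, hsb]
  have := le_csSup hbdd hmem
  rw [hsn] at this
  omega

end Poset

/-! ## Rings: transport of the catenary condition, permanence, local nature -/

section Ring

variable {B : Type u} [CommRing B]

open PrimeSpectrum

/-- **Transport of catenarity along an order embedding of spectra with order-connected range.**
For an order embedding `F : Spec C ↪ Spec B` whose range is order-connected (an interval-closed
set of primes, e.g. `V(I)` or the primes missing a multiplicative set) and primes `𝔭 ⊆ 𝔮` of `C`:
saturated chains from `𝔭` to `𝔮` exist and all have the same length iff the same holds from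
`F 𝔭` to `F 𝔮` in `Spec B`. [folklore] -/
theorem saturatedChain_clause_iff {C : Type u} [CommRing C]
    (F : PrimeSpectrum C ↪o PrimeSpectrum B) (hF : (Set.range F).OrdConnected)
    (p q : PrimeSpectrum C) :
    (∃ n : ℕ, (∃ s : LTSeries (PrimeSpectrum C), s.head = p ∧ s.last = q ∧ IsSaturatedChain s ∧
        s.length = n) ∧
      ∀ s : LTSeries (PrimeSpectrum C), s.head = p → s.last = q → IsSaturatedChain s →
        s.length = n) ↔
    (∃ n : ℕ, (∃ t : LTSeries (PrimeSpectrum B), t.head = F p ∧ t.last = F q ∧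
        IsSaturatedChain t ∧ t.length = n) ∧
      ∀ t : LTSeries (PrimeSpectrum B), t.head = F p → t.last = F q → IsSaturatedChain t →
        t.length = n) :=
  saturated_clause_iff F hF p q

/-- The order embedding `Spec C ↪ Spec B` of a surjection `B → C` (onto `V(ker)`), packaged with
the two facts used below: its range is order-connected and it is `Spec` of the surjection.
[folklore] -/
theorem exists_orderEmbedding_of_surjective {C : Type u} [CommRing C] (f : B →+* C)
    (hf : Function.Surjective f) :
    ∃ F : PrimeSpectrum C ↪o PrimeSpectrum B, (Set.range F).OrdConnected ∧
      Set.range F = zeroLocus (RingHom.ker f : Set B) ∧ ∀ x, F x = comap f x := by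
  let e := Ideal.primeSpectrumOrderIsoZeroLocusOfSurj f hf rfl
  let F : PrimeSpectrum C ↪o PrimeSpectrum B :=
    e.toOrderEmbedding.trans (OrderEmbedding.subtype _)
  have hrange : Set.range F = zeroLocus (RingHom.ker f : Set B) := by
    ext x
    constructor
    · rintro ⟨y, rfl⟩
      exact (e y).2
    · intro hx
      refine ⟨e.symm ⟨x, hx⟩, ?_⟩
      show ((e (e.symm ⟨x, hx⟩) : zeroLocus (RingHom.ker f : Set B)) : PrimeSpectrum B) = x
      rw [e.apply_symm_apply]
  refine ⟨F, ?_, hrange, fun x => rfl⟩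
  rw [hrange]
  refine IsUpperSet.ordConnected fun x y hxy hx => ?_
  rw [mem_zeroLocus] at hx ⊢
  exact fun a ha => hxy (hx ha)

/-- **Stacks 00NK: a quotient of a catenary ring is catenary** — more generally the target of a
surjective ring homomorphism `B → C` from a catenary ring (`Spec C ≅ V(ker) ⊆ Spec B` is an
interval-closed subposet). [cite: StacksProject, Tag 00NK] -/
theorem IsCatenaryRing.of_surjective {C : Type u} [CommRing C] (f : B →+* C)
    (hf : Function.Surjective f) (h : IsCatenaryRing B) : IsCatenaryRing C := by
  obtain ⟨F, hF, -, -⟩ := exists_orderEmbedding_of_surjective f hf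
  intro p q hpq
  exact (saturatedChain_clause_iff F hF p q).mpr (h (F p) (F q) (F.monotone hpq))

/-- A quotient of a catenary ring is catenary (Stacks 00NK). [cite: StacksProject, Tag 00NK] -/
theorem IsCatenaryRing.quotient (h : IsCatenaryRing B) (I : Ideal B) : IsCatenaryRing (B ⧸ I) :=
  h.of_surjective (Ideal.Quotient.mk I) Ideal.Quotient.mk_surjective

/-- Catenarity is invariant under ring isomorphisms. [folklore] -/
theorem IsCatenaryRing.of_ringEquiv {C : Type u} [CommRing C] (e : B ≃+* C) (h : IsCatenaryRing B) :
    IsCatenaryRing C :=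
  h.of_surjective e.toRingHom e.surjective

/-- **Catenarity can be checked on quotients containing the pair of primes**: if for all primes
`𝔭 ⊆ 𝔮` of `B` some quotient `B/I` with `I ⊆ 𝔭` is catenary, then `B` is catenary (the
saturated chains between `𝔭` and `𝔮` live in `V(I) ≅ Spec(B/I)`). In particular (Stacks 0AUP (1))
`B` is catenary as soon as `B/𝔭₀` is for every minimal prime `𝔭₀`. [cite: StacksProject, Tag 0AUP] -/
theorem isCatenaryRing_of_forall_exists_quotient
    (h : ∀ p q : PrimeSpectrum B, p ≤ q → ∃ I : Ideal B, I ≤ p.asIdeal ∧ IsCatenaryRing (B ⧸ I)) :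
    IsCatenaryRing B := by
  intro p q hpq
  obtain ⟨I, hIp, hcat⟩ := h p q hpq
  obtain ⟨F, hF, hrange, -⟩ :=
    exists_orderEmbedding_of_surjective (Ideal.Quotient.mk I) Ideal.Quotient.mk_surjective
  rw [Ideal.mk_ker] at hrange
  have hp : p ∈ Set.range F := by
    rw [hrange, mem_zeroLocus]
    exact hIp
  have hq : q ∈ Set.range F := by
    rw [hrange, mem_zeroLocus]
    exact fun a ha => hpq (hIp ha)
  obtain ⟨p', rfl⟩ := hp
  obtain ⟨q', rfl⟩ := hq
  exact (saturatedChain_clause_iff F hF p' q').mp (hcat p' q' (F.le_iff_le.mp hpq))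

/-- A ring all of whose quotients by minimal primes are catenary is catenary (Stacks 0AUP (1),
"if" direction). [cite: StacksProject, Tag 0AUP] -/
theorem isCatenaryRing_of_minimalPrimes
    (h : ∀ p ∈ minimalPrimes B, IsCatenaryRing (B ⧸ p)) : IsCatenaryRing B := by
  refine isCatenaryRing_of_forall_exists_quotient fun p q _ => ?_
  obtain ⟨p₀, hp₀, hp₀p⟩ := Ideal.exists_minimalPrimes_le (show (⊥ : Ideal B) ≤ p.asIdeal from bot_le)
  exact ⟨p₀, hp₀p, h p₀ hp₀⟩

/-- The order embedding `Spec(S⁻¹B) ↪ Spec B` of a localisation, with its range (the primes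
missing `S`, an order-connected — indeed lower — set). [folklore] -/
theorem exists_orderEmbedding_of_isLocalization (M : Submonoid B) (L : Type u) [CommRing L]
    [Algebra B L] [IsLocalization M L] :
    ∃ F : PrimeSpectrum L ↪o PrimeSpectrum B, (Set.range F).OrdConnected ∧
      Set.range F = {p | Disjoint (M : Set B) p.asIdeal} ∧ ∀ x, F x = comap (algebraMap B L) x := by
  let e := IsLocalization.primeSpectrumOrderIso M L
  let F : PrimeSpectrum L ↪o PrimeSpectrum B :=
    e.toOrderEmbedding.trans (OrderEmbedding.subtype _)
  have hrange : Set.range F = {p | Disjoint (M : Set B) p.asIdeal} := by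
    ext x
    constructor
    · rintro ⟨y, rfl⟩
      exact (e y).2
    · intro hx
      refine ⟨e.symm ⟨x, hx⟩, ?_⟩
      show ((e (e.symm ⟨x, hx⟩) : {p : PrimeSpectrum B // Disjoint (M : Set B) p.asIdeal}) :
        PrimeSpectrum B) = x
      rw [e.apply_symm_apply]
  refine ⟨F, ?_, hrange, fun x => rfl⟩
  rw [hrange]
  refine IsLowerSet.ordConnected fun x y hyx hx => ?_
  exact Disjoint.mono_right (show (y.asIdeal : Set B) ⊆ x.asIdeal from fun a ha => hyx ha) hx

/-- **Stacks 00NJ: a localisation of a catenary ring is catenary.**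
[cite: StacksProject, Tag 00NJ] -/
theorem IsCatenaryRing.of_isLocalization (M : Submonoid B) (L : Type u) [CommRing L]
    [Algebra B L] [IsLocalization M L] (h : IsCatenaryRing B) : IsCatenaryRing L := by
  obtain ⟨F, hF, -, -⟩ := exists_orderEmbedding_of_isLocalization M L
  intro p q hpq
  exact (saturatedChain_clause_iff F hF p q).mpr (h (F p) (F q) (F.monotone hpq))

/-- **Stacks 0AUN, (3) ⇒ (1): catenarity is local** — if `B_𝔪` is catenary for every maximal
ideal `𝔪` then `B` is catenary (chains between `𝔭 ⊆ 𝔮 ⊆ 𝔪` correspond to chains in `B_𝔪`).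
[cite: StacksProject, Tag 0AUN] -/
theorem isCatenaryRing_of_localization_maximal
    (h : ∀ (m : Ideal B) [m.IsMaximal], IsCatenaryRing (Localization.AtPrime m)) :
    IsCatenaryRing B := by
  intro p q hpq
  obtain ⟨m, hm, hqm⟩ := Ideal.exists_le_maximal q.asIdeal q.2.ne_top
  obtain ⟨F, hF, hrange, -⟩ :=
    exists_orderEmbedding_of_isLocalization m.primeCompl (Localization.AtPrime m)
  have hmem : ∀ x : PrimeSpectrum B, x.asIdeal ≤ m → x ∈ Set.range F := fun x hx => by
    rw [hrange]
    exact Set.disjoint_left.mpr fun a ha hax => (show a ∉ m from ha) (hx hax)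
  obtain ⟨p', rfl⟩ := hmem p (fun a ha => hqm (hpq ha))
  obtain ⟨q', rfl⟩ := hmem q hqm
  exact (saturatedChain_clause_iff F hF p' q').mp (h m p' q' (F.le_iff_le.mp hpq))

/-- **Stacks 0AUN, (2) ⇒ (1)**: if `B_𝔮` is catenary for every prime `𝔮` then `B` is catenary.
[cite: StacksProject, Tag 0AUN] -/
theorem isCatenaryRing_of_localization_prime
    (h : ∀ (q : Ideal B) [q.IsPrime], IsCatenaryRing (Localization.AtPrime q)) :
    IsCatenaryRing B :=
  isCatenaryRing_of_localization_maximal fun m _ => h m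

/-- **Catenarity is local, closed-point form**: `B` is catenary as soon as, for every prime `𝔮`
and every prime `P` of `B_𝔮`, the saturated chains from `P` to the closed point of `Spec B_𝔮`
exist and all have the same length (chains between `𝔭 ⊆ 𝔮` in `Spec B` are chains from `𝔭B_𝔮`
to `𝔮B_𝔮`). This is the form in which catenarity of rings with good local rings (regular,
Cohen–Macaulay) is established. [folklore] -/
theorem isCatenaryRing_of_clause_closedPoint
    (h : ∀ (q : Ideal B) [q.IsPrime] (P : PrimeSpectrum (Localization.AtPrime q)),
      ∃ n : ℕ, (∃ s : LTSeries (PrimeSpectrum (Localization.AtPrime q)), s.head = P ∧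
          s.last = IsLocalRing.closedPoint _ ∧ IsSaturatedChain s ∧ s.length = n) ∧
        ∀ s : LTSeries (PrimeSpectrum (Localization.AtPrime q)), s.head = P →
          s.last = IsLocalRing.closedPoint _ → IsSaturatedChain s → s.length = n) :
    IsCatenaryRing B := by
  intro p q hpq
  obtain ⟨F, hF, hrange, hFc⟩ :=
    exists_orderEmbedding_of_isLocalization q.asIdeal.primeCompl (Localization.AtPrime q.asIdeal)
  have hp : p ∈ Set.range F := by
    rw [hrange]
    exact Set.disjoint_left.mpr fun a ha hap => (show a ∉ q.asIdeal from ha) (hpq hap)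
  obtain ⟨p', rfl⟩ := hp
  have hq : F (IsLocalRing.closedPoint _) = q := by
    rw [hFc]
    ext1
    exact Localization.AtPrime.under_maximalIdeal (I := q.asIdeal)
  have := (saturatedChain_clause_iff F hF p' (IsLocalRing.closedPoint _)).mp (h q.asIdeal p')
  rwa [hq] at this

/-! ## Existence of saturated chains and the height criterion (Noetherian rings) -/

/-- In a Noetherian ring every pair of primes `𝔭 ⊆ 𝔮` is joined by a saturated chain (primes have
finite height, so a chain of maximal length exists and is saturated). [folklore] -/
theorem exists_isSaturatedChain [IsNoetherianRing B] {p q : PrimeSpectrum B} (hpq : p ≤ q) :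
    ∃ s : LTSeries (PrimeSpectrum B), s.head = p ∧ s.last = q ∧ IsSaturatedChain s :=
  exists_saturated_ltSeries hpq (by
    rw [← PrimeSpectrum.height_eq_orderHeight]
    exact Ideal.height_lt_top_of_isPrime)

/-- Along a saturated chain in a Noetherian ring in which covering pairs of primes raise the
height by exactly one, the height of the last prime is the height of the first plus the length.
[folklore] -/
theorem height_last_eq_of_isSaturatedChain
    (h : ∀ p q : PrimeSpectrum B, p ⋖ q → q.asIdeal.height = p.asIdeal.height + 1)
    (s : LTSeries (PrimeSpectrum B)) (hs : IsSaturatedChain s) :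
    s.last.asIdeal.height = s.head.asIdeal.height + s.length := by
  suffices H : ∀ i : Fin (s.length + 1), (s i).asIdeal.height = s.head.asIdeal.height + (i : ℕ) from
    H (Fin.last _)
  intro i
  induction i using Fin.induction with
  | zero => simp [RelSeries.head]
  | succ i ih =>
    rw [h _ _ (hs i), ih, Fin.val_succ, Nat.cast_add, Nat.cast_one, add_assoc, Fin.val_castSucc]

/-- **Height criterion for catenarity**: a Noetherian ring in which `ht 𝔮 = ht 𝔭 + 1` whenever
`𝔮` covers `𝔭` is catenary — every saturated chain from `𝔭` to `𝔮` then has length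
`ht 𝔮 − ht 𝔭` (this is how Cohen–Macaulay, in particular regular, rings are shown to be catenary:
Matsumura Thm. 17.4, Stacks 00N9/00NM). [folklore] -/
theorem isCatenaryRing_of_height_eq_height_add_one [IsNoetherianRing B]
    (h : ∀ p q : PrimeSpectrum B, p ⋖ q → q.asIdeal.height = p.asIdeal.height + 1) :
    IsCatenaryRing B := by
  intro p q hpq
  obtain ⟨s₀, h₀p, h₀q, h₀⟩ := exists_isSaturatedChain hpq
  refine ⟨s₀.length, ⟨s₀, h₀p, h₀q, h₀, rfl⟩, fun s hsp hsq hs => ?_⟩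
  have e₁ := height_last_eq_of_isSaturatedChain h s hs
  have e₀ := height_last_eq_of_isSaturatedChain h s₀ h₀
  rw [hsp, hsq] at e₁
  rw [h₀p, h₀q] at e₀
  obtain ⟨a, ha⟩ := ENat.ne_top_iff_exists.mp (Ideal.height_ne_top_of_isPrime (I := p.asIdeal))
  obtain ⟨b, hb⟩ := ENat.ne_top_iff_exists.mp (Ideal.height_ne_top_of_isPrime (I := q.asIdeal))
  rw [← ha, ← hb] at e₁ e₀
  have h₁ : b = a + s.length := by exact_mod_cast e₁
  have h₂ : b = a + s₀.length := by exact_mod_cast e₀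
  omega

/-- **Reduction to chains issuing from minimal primes**: in a Noetherian ring, if for every
minimal prime `𝔭₀ ⊆ 𝔭` all saturated chains from `𝔭₀` to `𝔮` have one and the same length, then
the saturated chains from `𝔭` to `𝔮` exist and all have the same length (prepend a fixed saturated
chain from `𝔭₀` to `𝔭`). This turns "maximal chains of primes in `R_𝔮` all have length `dim R_𝔮`"
(Stacks 00N9) into catenarity. [folklore] -/
theorem saturatedChain_clause_of_minimalPrimes [IsNoetherianRing B] {p q : PrimeSpectrum B}
    (hpq : p ≤ q)
    (h : ∀ p₀ : PrimeSpectrum B, p₀.asIdeal ∈ minimalPrimes B → p₀ ≤ p → ∃ d : ℕ,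
      ∀ s : LTSeries (PrimeSpectrum B), s.head = p₀ → s.last = q → IsSaturatedChain s →
        s.length = d) :
    ∃ n : ℕ, (∃ s : LTSeries (PrimeSpectrum B), s.head = p ∧ s.last = q ∧ IsSaturatedChain s ∧
        s.length = n) ∧
      ∀ s : LTSeries (PrimeSpectrum B), s.head = p → s.last = q → IsSaturatedChain s →
        s.length = n := by
  obtain ⟨s₀, h₀p, h₀q, h₀⟩ := exists_isSaturatedChain hpq
  obtain ⟨p₀, hp₀, hp₀p⟩ :=
    Ideal.exists_minimalPrimes_le (show (⊥ : Ideal B) ≤ p.asIdeal from bot_le)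
  let P₀ : PrimeSpectrum B := ⟨p₀, hp₀.1.1⟩
  have hP₀p : P₀ ≤ p := hp₀p
  obtain ⟨r, hrp₀, hrp, hr⟩ := exists_isSaturatedChain hP₀p
  obtain ⟨d, hd⟩ := h P₀ hp₀ hP₀p
  have key : ∀ s : LTSeries (PrimeSpectrum B), s.head = p → s.last = q → IsSaturatedChain s →
      r.length + s.length = d := by
    intro s hsp hsq hs
    have hconn : r.last = s.head := by rw [hrp, hsp]
    have := hd (r.smash s hconn) (by rw [RelSeries.head_smash, hrp₀])
      (by rw [RelSeries.last_smash, hsq]) (forall_covBy_smash hconn hr hs)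
    exact this
  refine ⟨s₀.length, ⟨s₀, h₀p, h₀q, h₀, rfl⟩, fun s hsp hsq hs => ?_⟩
  have e₁ := key s hsp hsq hs
  have e₀ := key s₀ h₀p h₀q h₀
  omega

/-- A Noetherian ring is catenary as soon as for all primes `𝔭₀ ⊆ 𝔮` with `𝔭₀` minimal the
saturated chains from `𝔭₀` to `𝔮` all have the same length. [folklore] -/
theorem isCatenaryRing_of_minimalPrimes_clause [IsNoetherianRing B]
    (h : ∀ p₀ q : PrimeSpectrum B, p₀.asIdeal ∈ minimalPrimes B → p₀ ≤ q → ∃ d : ℕ,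
      ∀ s : LTSeries (PrimeSpectrum B), s.head = p₀ → s.last = q → IsSaturatedChain s →
        s.length = d) :
    IsCatenaryRing B := fun _ q hpq =>
  saturatedChain_clause_of_minimalPrimes hpq fun p₀ hp₀ hp₀p => h p₀ q hp₀ (hp₀p.trans hpq)

end Ring

/-! ## Universally catenary rings: permanence -/

section Universally

variable {A : Type u} [CommRing A]

/-- A finitely generated algebra over a universally catenary ring is catenary (definition).
[folklore] -/
theorem IsUniversallyCatenaryRing.isCatenaryRing_of_finiteType (hA : IsUniversallyCatenaryRing A)
    (B : Type u) [CommRing B] [Algebra A B] [Algebra.FiniteType A B] : IsCatenaryRing B :=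
  hA.2 B ‹_›

/-- **Stacks 0ECE (first half): a finite type algebra over a universally catenary ring is
universally catenary** (finite type over finite type is finite type; Noetherian by Hilbert's
basis theorem). [cite: StacksProject, Tag 0ECE] -/
theorem IsUniversallyCatenaryRing.of_finiteType (hA : IsUniversallyCatenaryRing A)
    (B : Type u) [CommRing B] [Algebra A B] [Algebra.FiniteType A B] :
    IsUniversallyCatenaryRing B := by
  haveI : IsNoetherianRing A := hA.1
  refine ⟨Algebra.FiniteType.isNoetherianRing A B, fun C _ _ hC => ?_⟩
  letI : Algebra A C := ((algebraMap B C).comp (algebraMap A B)).toAlgebra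
  haveI : IsScalarTower A B C := IsScalarTower.of_algebraMap_eq fun _ => rfl
  exact hA.2 C (Algebra.FiniteType.trans ‹Algebra.FiniteType A B› hC)

/-- A finite algebra over a universally catenary ring is universally catenary. [folklore] -/
theorem IsUniversallyCatenaryRing.of_finite (hA : IsUniversallyCatenaryRing A)
    (B : Type u) [CommRing B] [Algebra A B] [Module.Finite A B] :
    IsUniversallyCatenaryRing B :=
  hA.of_finiteType B

/-- **Stacks 00NK (second half): the target of a surjection from (e.g. a quotient of) a
universally catenary ring is universally catenary.** [cite: StacksProject, Tag 00NK] -/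
theorem IsUniversallyCatenaryRing.of_surjective (hA : IsUniversallyCatenaryRing A)
    {B : Type u} [CommRing B] (f : A →+* B) (hf : Function.Surjective f) :
    IsUniversallyCatenaryRing B := by
  letI : Algebra A B := f.toAlgebra
  haveI : Algebra.FiniteType A B :=
    Algebra.FiniteType.of_surjective (Algebra.ofId A B) hf
  exact hA.of_finiteType B

/-- A quotient of a universally catenary ring is universally catenary (Stacks 00NK).
[cite: StacksProject, Tag 00NK] -/
theorem IsUniversallyCatenaryRing.quotient (hA : IsUniversallyCatenaryRing A) (I : Ideal A) :
    IsUniversallyCatenaryRing (A ⧸ I) :=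
  hA.of_surjective (Ideal.Quotient.mk I) Ideal.Quotient.mk_surjective

/-- **Universal catenarity is checked on polynomial rings** (Stacks, remark after Definition
00NL: "By Lemma 00NK to check a Noetherian ring `R` is universally catenary, it suffices to check
each polynomial algebra `R[x_1, …, x_n]` is catenary"): every finitely generated `A`-algebra is a
quotient of some `A[X_1, …, X_n]`. [cite: StacksProject, Tag 00NL] -/
theorem isUniversallyCatenaryRing_of_mvPolynomial [IsNoetherianRing A]
    (h : ∀ n : ℕ, IsCatenaryRing (MvPolynomial (Fin n) A)) : IsUniversallyCatenaryRing A := by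
  refine ⟨‹_›, fun B _ _ hB => ?_⟩
  obtain ⟨n, f, hf⟩ := Algebra.FiniteType.iff_quotient_mvPolynomial''.mp hB
  exact (h n).of_surjective f.toRingHom hf

/-- **Regular rings are universally catenary, given that regular local rings are catenary**
(the assembly of Stacks 00NM/00NQ, Matsumura Thms. 17.8–17.9, around the one local input
"a regular local ring is catenary", Matsumura Thm. 17.4 (ii) with Thm. 17.8): polynomial rings
over a regular ring are regular (Mathlib), their local rings are regular local rings, catenarity
is local (`isCatenaryRing_of_localization_prime`), and universal catenarity is checked on
polynomial rings (`isUniversallyCatenaryRing_of_mvPolynomial`). [folklore] -/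
theorem isUniversallyCatenaryRing_of_isRegularRing
    (H : ∀ (T : Type u) [CommRing T], IsRegularLocalRing T → IsCatenaryRing T)
    (R : Type u) [CommRing R] [IsRegularRing R] : IsUniversallyCatenaryRing R :=
  isUniversallyCatenaryRing_of_mvPolynomial fun _ =>
    isCatenaryRing_of_localization_prime fun q _ =>
      H _ (IsRegularRing.isRegularLocalRing_localization q)

end Universally

end Literature.AlgebraicGeometry.Resolution
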